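import Mathlib

/-!
# `Balaban1983to89.B12Sec5Algebra` — [Balaban1987RG1] §5, pp. 294–297: the finite algebra behind the representation
(5.16)/(5.37) `Π̃_{μν}(p) = β(δ_{μν}Δ(p) − ∂̄_μ(p)∂_ν(p)) + …` — (5.26) + (5.30) ⇒ (5.33), (5.21) ⇒ (5.34), ⇒ (5.35)–(5.36),
(5.40)–(5.41) — reproduced, and the one located slip

CITATION HEADER (lean-in-tree rule 2026-08-18).  Source: T. Bałaban, *Renormalization group approach to lattice gauge
field theories. I. Generation of effective actions in a small field approximation and a coupling constant
renormalization in four dimensions*, Commun. Math. Phys. **109**, 249–301 (1987), doi:10.1007/bf01215223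
[Balaban1987RG1] (held: `paper:balaban1987-cmp109-rg-i-small-field`; journal page = PDF page + 248; every formula below
was read from the 300-dpi page renders of pp. 294–297 [PDF 46–49], not from an OCR layer).  Companion modules:
`…Balaban1983to89.B12` (§§0–1, Theorems 1–3), `…B12Beta` ((1.20)–(1.22)), `…B12Sec2to5` (§§2–5 skeleton: Lemma 4,
(5.10), (5.42); its header records that the DERIVATION (5.16)–(5.44) was transcribed and audited but not typed).  This
module types and KERNEL-CHECKS the finite symbolic computation of that derivation which the two earlier readings of §5
in the audit cell left unreproduced (`HOME/GAPS.md` C-B12s-5: "(5.33) = 'simple algebraic transformations' … NOT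
re-derived (a page of algebra)"; C-adv2-1: "(5.33) itself … and the system (5.34) … finite symbolic computations,
decidable, not written in print — NOT re-derived").  Audit cell `pub-balaban`, sub-cell B12 gen 2, unit
`b2b-balaban-b12-g2`, row P12b-§5alg.  Value = certificate + one located (harmless) slip, NOT summit progress.
Second, independent engine: the exact rational symbolic script `HOME/b2b-balaban-b12-g2/sec5_algebra.py` (pure Python,
d = 2, 3, 4; log `sec5_algebra.log`), which agrees with every statement below.

THE PRINTED TEXT (verbatim, p. 294–297).
* (5.17) p. 294: `f_{μν}(z₁,…,z_d) = Π̃_{μν}((1/i) log z₁, …, (1/i) log z_d)`, `e^{−δ₁} < |z_μ| < e^{δ₁}`; "The functions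
  f_{μν}(z) are analytic on the polyring ×_μ{e^{−δ₁} < |z_μ| < e^{δ₁}}, and the properties (5.12)–(5.15) imply the
  following ones:" (5.18) `f_{μν}(rz) = ((r⊗r)f)_{μν}(z)` if r is a permutation, (5.19) `f_{μν}(z^ε) = ε_με_ν
  z_μ^{−(1−ε_μ)/2} z_ν^{(1−ε_ν)/2} f_{μν}(z)`, (5.20) `f_{μν}(z) = f_{νμ}(z⁻¹)`, (5.21) `Σ_μ (z_μ⁻¹ − 1)f_{μν}(z) =
  Σ_ν (z_ν − 1)f_{μν}(z) = 0`.
* p. 294, the one-variable splitting: "a given function f(z) analytic on the ring {e^{−δ₁} < |z| < e^{δ₁}} can be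
  represented as f(z) = g⁺(z) + g⁻(z⁻¹), where g⁺(z), g⁻(z) are analytic on the disc {|z| < e^{δ₁}}. … If the index of
  this component is different from μ, ν, then the transformation law in the one variable is f(z⁻¹) = f(z). The
  normalization condition g⁺(0) = g⁻(0) implies then g⁻(z) = g⁺(z), and we have the representation f(z) = g(z) + g(z⁻¹),
  g(z) = g⁺(z). If the index is equal to μ, then the transformation law is f(z⁻¹) = −z⁻¹f(z). The normalization
  condition g⁺(0) = 0 implies g⁻(z) = −z⁻¹g⁺(z), and we have f(z) = g(z) − zg(z⁻¹). Finally, if the index is equal to ν,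
  then f(z⁻¹) = −zf(z), and the normalization condition g⁻(0) = 0 implies g⁻(z) = −zg⁺(z), f(z) = g(z) − z⁻¹g(z⁻¹)."
  — `opS`, `opM`, `opN` below, with their laws `opS_inv`, `opM_inv`, `opN_inv`.
* (5.22) `f_{μν}(z) = Σ_ε g^ε_{μν}(z^ε)`, "where the functions g^ε_{μν}(z) are analytic on the polydisc ×_μ{|z_μ| <
  e^{δ₁}}"; (5.23) normalization `g^{(ε′,ε_λ=+1,ε″)}_{μν}(z′,0,z″) = g^{(ε′,ε_λ=−1,ε″)}(z′,0,z″)` "for the indices λ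
  different from μ, ν, if μ ≠ ν, or for all the indices λ, if μ = ν"; (5.26) p. 295: `f_{μν}(z) = Σ_ε ε_με_ν
  z_μ^{(1−ε_μ)/2} z_ν^{−(1−ε_ν)/2} g_{μν}(z^ε)` — `F11`, `F12`, `F21` below (d = 4, unrolled over the 16 sign vectors ε;
  for μ = ν the prefactor is 1); (5.27) `g_{μν}(rz) = ((r⊗r)g)_{μν}(z)`; "The equalities (5.19) are implied by the form
  of the representation (5.26). The equalities (5.20) are equivalent to (5.28) `g_{μν}(z) = z_ν⁻¹z_μ g_{νμ}(z)`."
* (5.30) p. 295: `g_{μν}(z) = g_{μν}(1) + Σ_κ a_{μν,κ}(z_κ − 1) + ½Σ_{κ,λ} b_{μν,κλ}(z_κ − 1)(z_λ − 1) + Σ_{κ,λ,ρ}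
  g_{μν,κλρ}(z)(z_κ − 1)(z_λ − 1)(z_ρ − 1)` (a = first, b = second z-derivatives of g_{μν} at 1) — `T2.g` below (the
  terms of order ≤ 2; d = 4).
* (5.33) p. 296: "Now we substitute the expansion (5.30) into the representation (5.26). … Writing explicitly only the
  lower order terms, and making simple algebraic transformations, we finally get the following representation:
  `f_{μν}(z) = δ_{μν}2^{d−2}g_{μμ}(1)[4 − (z_μ⁻¹ − 1)(z_μ − 1)] + 2^{d−2}[g_{μν}(1) − 2a_{μν,μ} + 2a_{μν,ν} −
  4b_{μν,μν}](z_μ⁻¹ − 1)(z_ν − 1) − δ_{μν}2^{d−1}[Σ_κ(a_{μμ,κ} + b_{μμ,κκ})(z_κ⁻¹ − 1)(z_κ − 1) − 2(a_{μμ,μ} +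
  b_{μμ,μμ})(z_μ⁻¹ − 1)(z_μ − 1)] + Σ_{κ,λ,ρ}[f′_{μν,κλρ}(z)(z_κ⁻¹ − 1)(z_λ⁻¹ − 1)(z_ρ⁻¹ − 1) + f′_{μν,κ,λρ}(z)(z_κ − 1)
  (z_λ⁻¹ − 1)(z_ρ⁻¹ − 1) + …]`, where the dots denote summation over other possible third order monomials in z⁻¹ − 1,
  z − 1. The coefficients f′ are analytic functions on the polyring in (5.17)."
* p. 296: "For z = 1 we get f_{μν}(1) = δ_{μν}2^d g_{μμ}(1), hence f_{μν}(1) = 0 for μ ≠ ν. Differentiating the second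
  identity in (5.21) with respect to z_μ and taking it at the point 1 yields f_{μμ}(1) = 0, hence g_{μμ}(1) = 0 … We
  multiply (5.33) by z_ν − 1, sum over ν, and we obtain an expression identically equal to 0. … We have to consider third
  order terms only, and the equations are (5.34) `g_{μν}(1) − 2a_{μν,μ} + 2a_{μν,ν} − 4b_{μν,μν} = 2(a_{μμ,ν} + b_{μμ,νν})`
  for μ ≠ ν, `g_{μμ}(1) − 2a_{μμ,μ} + 2a_{μμ,μ} − 4b_{μμ,μμ} = −2(a_{μμ,μ} + b_{μμ,μμ})`. Denoting the left-hand side of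
  these equations by −β_{μν}, we have (5.35) `f_{μν}(z) = −2^{d−2}β_{μν}(z_μ⁻¹ − 1)(z_ν − 1) + δ_{μν}2^{d−2}Σ_κ β_{μκ}
  (z_κ⁻¹ − 1)(z_κ − 1) + …`. … They imply that all the coefficients β_{μν} for μ ≠ ν are equal. Denoting the common
  value of 2^{d−2}β_{μν} by β, we get (5.36) `f_{μν}(z) = β(δ_{μν}Σ_κ(z_κ⁻¹ − 1)(z_κ − 1) − (z_μ⁻¹ − 1)(z_ν − 1)) + …`."
* p. 297: (5.39) `β = 2^{d−2}(−g_{μν}(1) + 2a_{μν,μ} − 2a_{μν,ν} + 4b_{μν,μν})` for μ ≠ ν; "The representation (5.26)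
  yields" (5.40) `f₁₂(z₁,z₂,1) = 2^{d−2}(z₁z₂⁻¹g₁₂(z₁⁻¹,z₂⁻¹,1) − z₂⁻¹g₁₂(z₁,z₂⁻¹,1) − z₁g₁₂(z₁⁻¹,z₂,1) + g₁₂(z₁,z₂,1))`;
  "Differentiating it with respect to z₁, z₂, at z₁ = z₂ = 1, we obtain" (5.41) `(∂²f₁₂/∂z₁∂z₂)(1) = 2^{d−2}(−g₁₂(1) +
  2a₁₂,₁ − 2a₁₂,₂ + 4b₁₂,₁₂) = β`.

WHAT IS KERNEL-CHECKED HERE (d = 4, hence 2^{d−2} = 4, 2^{d−1} = 8, 2^d = 16; pairs (μ,ν) = (1,1) and (1,2) — the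
others are their images under (5.27); real variables z_κ ≠ 0, i.e. points of the polyring; "third order" is made
EXACT: every identity below is an equality with an explicitly displayed remainder each of whose summands carries at
least three factors from {z_κ − 1, z_κ⁻¹ − 1} times a Laurent polynomial, which is the printed shape
"Σ f′(z)(·)(·)(·) + …, f′ analytic on the polyring").
* §A `opS/opM/opN_inv`: the three one-variable laws of p. 294; `opS/opM/opN_taylor₂`: their exact action on the
  quadratic Taylor polynomial — the engine of (5.33).
* §B `F11_flip*`, `F12_flip*`: "(5.19) is implied by the form of (5.26)"; `f12_eq_f21_inv`: (5.28) ⇒ (5.20);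
  `eq540`: (5.40) is (5.26) at z₃ = z₄ = 1.
* §C–§D `F12_quad`, `eq533_offdiag`: the OFF-DIAGONAL block of (5.33) is exactly right.  `F11_quad`, `eq533_diag`:
  substituting (5.30) into (5.26) for μ = ν gives `2^d g_{μμ}(1) − 2^{d−1}Σ_κ(a_{μμ,κ} + b_{μμ,κκ})(z_κ⁻¹−1)(z_κ−1)` +
  (fourth-order remainder), whereas the explicitly written part of the printed (5.33) is LARGER by
  `2^d a_{μμ,μ}(z_μ⁻¹ − 1)(z_μ − 1)` (`F11_sub_printed533`); witness `g_{μμ}(y) = y_μ − 1`: f_{μμ} = −8(z_μ⁻¹−1)(z_μ−1)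
  exactly, printed +8(z_μ⁻¹−1)(z_μ−1) (`printed533_diag_witness`), and the difference 16(z_μ − 1)²/z_μ is not a
  third-order remainder (`defect_not_third_order`).  Equivalently: the compensating term "−2(a_{μμ,μ} + b_{μμ,μμ})" in
  the third line of (5.33) should read "−2b_{μμ,μμ}".  THIS IS THE ONE LOCATED SLIP (GAPS G-b12g2-1); it is harmless,
  see §F and §I.
* §E `ward534`: the third-order coefficients of Σ_ν(z_ν − 1)f_{1ν}(z) vanish iff g₁₁(1) = 0, a₁₁,₁ + b₁₁,₁₁ = 0 and
  (5.34)₁ for ν ≠ 1 — (5.34)₁ VERBATIM; the diagonal equation is a₁₁,₁ + b₁₁,₁₁ = 0, whereas the printed (5.34)₂ (which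
  is what the printed third line of (5.33) gives: `ward534_printed`) reads a₁₁,₁ = b₁₁,₁₁ (given g₁₁(1) = 0).
* §F `eq535_diag_coeff`, `eq536_11`, `eq536_12`: on the solutions of the Ward equations the second-order part of f₁₁
  has NO (z₁⁻¹−1)(z₁−1) term at all, so (5.35) holds with β₁₁ ARBITRARY (it drops out — cf. `B12Sec2to5.diag536`), and
  with all β_{1ν} (ν ≠ 1) equal (5.36) holds with β = 4β₁₂ = (5.39) = (5.41) (`eq541_factor`): everything from (5.35)
  on, in particular the β-function (5.39)/(5.41)/(5.42), is UNAFFECTED by the slip.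
* §H `transverse_of_ward`, `transverse_jet` (general d): the structural content — hypercubic-parity shape of the
  second-order jets (a consequence of (5.26)) + the lattice Ward identity (5.21) + equality of the off-diagonal
  constants (5.32) force the jet `β(w_μw_ν − δ_{μν}|w|²)`, i.e. (5.36)/(5.37): the marginal part of the vacuum
  polarization is β × (the quadratic form of the linearised Wilson action) — "coupling constant renormalization" only.
* §I `vanish_of_odd_under_inversion`, `gdiag_axis_vanishes`: MOREOVER the printed lines are true for the functions at
  hand: (5.21) on the coordinate axis z = (1,…,z_μ,…,1) gives (z_μ − 1)f_{μμ} = 0 there, (5.26) gives f_{μμ} =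
  2^{d−1}(g_{μμ}(…,z_μ,…) + g_{μμ}(…,z_μ⁻¹,…)) there, and a function analytic on the disc |z| < e^{δ₁} (e^{δ₁} > 1) that
  is odd under z ↦ z⁻¹ on the ring vanishes identically (Liouville) — so g_{μμ}(1) = a_{μμ,μ} = b_{μμ,μμ} = 0: both the
  printed (5.34)₂ and the corrected equation hold (as 0 = 0), and the printed (5.33) is correct up to third order for
  the actual g_{μμ}, though not as the stated consequence of (5.26) + (5.30) alone.
NOTHING of the series is asserted; every `theorem` is kernel-checked algebra / elementary complex analysis over
explicit carriers (real or complex variables), every hypothesis is displayed.  Companion prose: `HOME/GAPS.md` rows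
G-b12g2-1, C-b12g2-1..3; `HOME/DIVERGENCE.md` D-b12g2-1..2.
-/

namespace Literature.MathematicalPhysics.QuantumFieldTheory.Balaban1983to89.B12Sec5Algebra

noncomputable section

open _root_.Finset

/-! ## §A. The one-variable Laurent-splitting operators of p. 294 [PDF 46] -/

/-- p. 294, index ∉ {μ, ν} (and every index when μ = ν): "f(z) = g(z) + g(z⁻¹)". [cite: Balaban1987RG1, §5 p.294] -/
def opS (h : ℝ → ℝ) (z : ℝ) : ℝ := h z + h z⁻¹

/-- p. 294, index = μ: "f(z) = g(z) − zg(z⁻¹)". [cite: Balaban1987RG1, §5 p.294] -/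
def opM (h : ℝ → ℝ) (z : ℝ) : ℝ := h z - z * h z⁻¹

/-- p. 294, index = ν: "f(z) = g(z) − z⁻¹g(z⁻¹)". [cite: Balaban1987RG1, §5 p.294] -/
def opN (h : ℝ → ℝ) (z : ℝ) : ℝ := h z - z⁻¹ * h z⁻¹

/-- p. 294: "the transformation law in the one variable is f(z⁻¹) = f(z)". [cite: Balaban1987RG1, §5 p.294] -/
theorem opS_inv (h : ℝ → ℝ) (z : ℝ) : opS h z⁻¹ = opS h z := by
  simp only [opS, inv_inv]; ring

/-- p. 294: "If the index is equal to μ, then the transformation law is f(z⁻¹) = −z⁻¹f(z)". [cite: Balaban1987RG1, §5 p.294] -/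
theorem opM_inv (h : ℝ → ℝ) {z : ℝ} (hz : z ≠ 0) : opM h z⁻¹ = -z⁻¹ * opM h z := by
  simp only [opM, inv_inv]; field_simp; ring

/-- p. 294: "if the index is equal to ν, then f(z⁻¹) = −zf(z)". [cite: Balaban1987RG1, §5 p.294] -/
theorem opN_inv (h : ℝ → ℝ) {z : ℝ} (hz : z ≠ 0) : opN h z⁻¹ = -z * opN h z := by
  simp only [opN, inv_inv]; field_simp; ring

/-- The one-variable quadratic Taylor polynomial at 1 (the order ≤ 2 part of (5.30) in one variable):
`h(y) = h₀ + h₁(y − 1) + (h₂/2)(y − 1)²`. [cite: Balaban1987RG1, (5.30) p.295] -/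
def taylor₂ (h₀ h₁ h₂ : ℝ) (y : ℝ) : ℝ := h₀ + h₁ * (y - 1) + h₂ / 2 * (y - 1) ^ 2

/-- The paper's second-order monomial `(z⁻¹ − 1)(z − 1) = 2 − z − z⁻¹` (= |e^{ip} − 1|² = the symbol of −Δ in one
variable on |z| = 1, cf. (5.36)–(5.37)). [cite: Balaban1987RG1, (5.33), (5.36) pp.296–297] -/
def um (z : ℝ) : ℝ := (z⁻¹ - 1) * (z - 1)

/-- `(z⁻¹ − 1)(z − 1) = 2 − z − z⁻¹ − (1 − z⁻¹z)` (no hypothesis on z). [folklore] -/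
theorem um_eq (z : ℝ) : um z = 2 - z - z⁻¹ - (1 - z⁻¹ * z) := by simp only [um]; ring

/-- `(z⁻¹ − 1)(z − 1) = 2 − z − z⁻¹` for z ≠ 0. [folklore] -/
theorem um_eq' {z : ℝ} (hz : z ≠ 0) : um z = 2 - z - z⁻¹ := by simp only [um]; field_simp; ring

/-- `z⁻¹ − 1 = −z⁻¹(z − 1)`: the substitution z ↦ z⁻¹ maps the ideal generated by (z − 1) into itself, so the
third-order remainder of (5.30) stays third order under (5.26) (p. 296: "the third order terms in (5.30) give rise to
the higher order terms of the remainder"). [folklore] -/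
theorem inv_sub_one {z : ℝ} (hz : z ≠ 0) : z⁻¹ - 1 = -z⁻¹ * (z - 1) := by field_simp; ring

/-- EXACT action of `opS` on the quadratic Taylor polynomial: `g(z) + g(z⁻¹) = 2h₀ − (h₁ + h₂)(z⁻¹−1)(z−1) +
(h₂/2)((z⁻¹−1)(z−1))²` — second-order part `2h₀ − (h₁ + h₂)·(z⁻¹−1)(z−1)`, the linear coefficient h₁ enters with the
sign MINUS (this is the sign the printed third line of (5.33) gets wrong for κ = μ). [cite: Balaban1987RG1, §5 p.294, (5.30), (5.33) pp.295–296] -/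
theorem opS_taylor₂ (h₀ h₁ h₂ : ℝ) {z : ℝ} (hz : z ≠ 0) :
    opS (taylor₂ h₀ h₁ h₂) z = 2 * h₀ - (h₁ + h₂) * um z + h₂ / 2 * um z ^ 2 := by
  simp only [opS, taylor₂, um]; field_simp; ring

/-- EXACT action of `opM`: `g(z) − zg(z⁻¹) = (2h₁ − h₀)(z − 1) + (h₂/2)(z − 1)³z⁻¹`. [cite: Balaban1987RG1, §5 p.294, (5.30), (5.33) pp.295–296] -/
theorem opM_taylor₂ (h₀ h₁ h₂ : ℝ) {z : ℝ} (hz : z ≠ 0) :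
    opM (taylor₂ h₀ h₁ h₂) z = (2 * h₁ - h₀) * (z - 1) + h₂ / 2 * (z - 1) ^ 3 * z⁻¹ := by
  simp only [opM, taylor₂]; field_simp; ring

/-- EXACT action of `opN`: `g(z) − z⁻¹g(z⁻¹) = −(h₀ + 2h₁)(z⁻¹ − 1) + [h₁(z⁻¹−1)·(z⁻¹−1)(z−1) + (h₂/2)(z⁻¹−1)²(z² −
z⁻¹)]`, the bracket being third order (z² − z⁻¹ = z⁻¹(z − 1)(z² + z + 1)). [cite: Balaban1987RG1, §5 p.294, (5.30), (5.33) pp.295–296] -/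
theorem opN_taylor₂ (h₀ h₁ h₂ : ℝ) {z : ℝ} (hz : z ≠ 0) :
    opN (taylor₂ h₀ h₁ h₂) z = -(h₀ + 2 * h₁) * (z⁻¹ - 1)
      + (h₁ * (z⁻¹ - 1) * um z + h₂ / 2 * (z⁻¹ - 1) ^ 2 * (z ^ 2 - z⁻¹)) := by
  simp only [opN, taylor₂, um]; field_simp; ring

/-! ## §B. (5.26) for d = 4, unrolled over the 16 sign vectors ε; (5.19), (5.20)/(5.28), (5.40) -/

/-- (5.26) p. 295 for d = 4, μ = ν = 1: `f₁₁(z) = Σ_ε g₁₁(z^ε)` (ε_με_ν z_μ^{(1−ε_μ)/2}z_ν^{−(1−ε_ν)/2} = 1 for μ = ν),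
`z^ε = (z₁^{ε₁}, …, z₄^{ε₄})`. [cite: Balaban1987RG1, (5.26) p.295] -/
def F11 (g : ℝ → ℝ → ℝ → ℝ → ℝ) (z₁ z₂ z₃ z₄ : ℝ) : ℝ :=
  g z₁ z₂ z₃ z₄ + g z₁ z₂ z₃ z₄⁻¹ + g z₁ z₂ z₃⁻¹ z₄ + g z₁ z₂ z₃⁻¹ z₄⁻¹
  + g z₁ z₂⁻¹ z₃ z₄ + g z₁ z₂⁻¹ z₃ z₄⁻¹ + g z₁ z₂⁻¹ z₃⁻¹ z₄ + g z₁ z₂⁻¹ z₃⁻¹ z₄⁻¹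
  + g z₁⁻¹ z₂ z₃ z₄ + g z₁⁻¹ z₂ z₃ z₄⁻¹ + g z₁⁻¹ z₂ z₃⁻¹ z₄ + g z₁⁻¹ z₂ z₃⁻¹ z₄⁻¹
  + g z₁⁻¹ z₂⁻¹ z₃ z₄ + g z₁⁻¹ z₂⁻¹ z₃ z₄⁻¹ + g z₁⁻¹ z₂⁻¹ z₃⁻¹ z₄ + g z₁⁻¹ z₂⁻¹ z₃⁻¹ z₄⁻¹

/-- (5.26) p. 295 for d = 4, (μ, ν) = (1, 2): the term of sign vector ε is `ε₁ε₂ z₁^{(1−ε₁)/2} z₂^{−(1−ε₂)/2}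
g₁₂(z^ε)`, i.e. `+g₁₂(z₁,z₂,·)`, `−z₁g₁₂(z₁⁻¹,z₂,·)`, `−z₂⁻¹g₁₂(z₁,z₂⁻¹,·)`, `+z₁z₂⁻¹g₁₂(z₁⁻¹,z₂⁻¹,·)`, summed over
the four sign choices in the variables 3, 4. [cite: Balaban1987RG1, (5.26) p.295] -/
def F12 (g : ℝ → ℝ → ℝ → ℝ → ℝ) (z₁ z₂ z₃ z₄ : ℝ) : ℝ :=
  (g z₁ z₂ z₃ z₄ + g z₁ z₂ z₃ z₄⁻¹ + g z₁ z₂ z₃⁻¹ z₄ + g z₁ z₂ z₃⁻¹ z₄⁻¹)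
  - z₁ * (g z₁⁻¹ z₂ z₃ z₄ + g z₁⁻¹ z₂ z₃ z₄⁻¹ + g z₁⁻¹ z₂ z₃⁻¹ z₄ + g z₁⁻¹ z₂ z₃⁻¹ z₄⁻¹)
  - z₂⁻¹ * (g z₁ z₂⁻¹ z₃ z₄ + g z₁ z₂⁻¹ z₃ z₄⁻¹ + g z₁ z₂⁻¹ z₃⁻¹ z₄ + g z₁ z₂⁻¹ z₃⁻¹ z₄⁻¹)
  + z₁ * z₂⁻¹ * (g z₁⁻¹ z₂⁻¹ z₃ z₄ + g z₁⁻¹ z₂⁻¹ z₃ z₄⁻¹ + g z₁⁻¹ z₂⁻¹ z₃⁻¹ z₄ + g z₁⁻¹ z₂⁻¹ z₃⁻¹ z₄⁻¹)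

/-- (5.26) p. 295 for d = 4, (μ, ν) = (2, 1): the term of sign vector ε is `ε₂ε₁ z₂^{(1−ε₂)/2} z₁^{−(1−ε₁)/2}
g₂₁(z^ε)`. [cite: Balaban1987RG1, (5.26) p.295] -/
def F21 (g : ℝ → ℝ → ℝ → ℝ → ℝ) (z₁ z₂ z₃ z₄ : ℝ) : ℝ :=
  (g z₁ z₂ z₃ z₄ + g z₁ z₂ z₃ z₄⁻¹ + g z₁ z₂ z₃⁻¹ z₄ + g z₁ z₂ z₃⁻¹ z₄⁻¹)
  - z₁⁻¹ * (g z₁⁻¹ z₂ z₃ z₄ + g z₁⁻¹ z₂ z₃ z₄⁻¹ + g z₁⁻¹ z₂ z₃⁻¹ z₄ + g z₁⁻¹ z₂ z₃⁻¹ z₄⁻¹)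
  - z₂ * (g z₁ z₂⁻¹ z₃ z₄ + g z₁ z₂⁻¹ z₃ z₄⁻¹ + g z₁ z₂⁻¹ z₃⁻¹ z₄ + g z₁ z₂⁻¹ z₃⁻¹ z₄⁻¹)
  + z₁⁻¹ * z₂ * (g z₁⁻¹ z₂⁻¹ z₃ z₄ + g z₁⁻¹ z₂⁻¹ z₃ z₄⁻¹ + g z₁⁻¹ z₂⁻¹ z₃⁻¹ z₄ + g z₁⁻¹ z₂⁻¹ z₃⁻¹ z₄⁻¹)

/-- "(5.19) is implied by the form of (5.26)" (p. 295), μ = ν = 1: f₁₁ is invariant under z₁ ↦ z₁⁻¹ … [cite: Balaban1987RG1, (5.19), (5.26) pp.294–295] -/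
theorem F11_flip1 (g : ℝ → ℝ → ℝ → ℝ → ℝ) (z₁ z₂ z₃ z₄ : ℝ) : F11 g z₁⁻¹ z₂ z₃ z₄ = F11 g z₁ z₂ z₃ z₄ := by
  simp only [F11, inv_inv]; ring

/-- (5.19), μ = ν = 1: f₁₁ is invariant under z₂ ↦ z₂⁻¹. [cite: Balaban1987RG1, (5.19), (5.26) pp.294–295] -/
theorem F11_flip2 (g : ℝ → ℝ → ℝ → ℝ → ℝ) (z₁ z₂ z₃ z₄ : ℝ) : F11 g z₁ z₂⁻¹ z₃ z₄ = F11 g z₁ z₂ z₃ z₄ := by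
  simp only [F11, inv_inv]; ring

/-- (5.19), μ = ν = 1: f₁₁ is invariant under z₃ ↦ z₃⁻¹. [cite: Balaban1987RG1, (5.19), (5.26) pp.294–295] -/
theorem F11_flip3 (g : ℝ → ℝ → ℝ → ℝ → ℝ) (z₁ z₂ z₃ z₄ : ℝ) : F11 g z₁ z₂ z₃⁻¹ z₄ = F11 g z₁ z₂ z₃ z₄ := by
  simp only [F11, inv_inv]; ring

/-- (5.19), μ = ν = 1: f₁₁ is invariant under z₄ ↦ z₄⁻¹. [cite: Balaban1987RG1, (5.19), (5.26) pp.294–295] -/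
theorem F11_flip4 (g : ℝ → ℝ → ℝ → ℝ → ℝ) (z₁ z₂ z₃ z₄ : ℝ) : F11 g z₁ z₂ z₃ z₄⁻¹ = F11 g z₁ z₂ z₃ z₄ := by
  simp only [F11, inv_inv]; ring

/-- (5.19) for (μ, ν) = (1, 2), flipping the variable μ = 1: `f₁₂(z₁⁻¹,z₂,z₃,z₄) = −z₁⁻¹f₁₂(z)`. [cite: Balaban1987RG1, (5.19), (5.26) pp.294–295] -/
theorem F12_flip1 (g : ℝ → ℝ → ℝ → ℝ → ℝ) {z₁ : ℝ} (h₁ : z₁ ≠ 0) (z₂ z₃ z₄ : ℝ) :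
    F12 g z₁⁻¹ z₂ z₃ z₄ = -z₁⁻¹ * F12 g z₁ z₂ z₃ z₄ := by
  simp only [F12, inv_inv]; field_simp; ring

/-- (5.19) for (μ, ν) = (1, 2), flipping the variable ν = 2: `f₁₂(z₁,z₂⁻¹,z₃,z₄) = −z₂f₁₂(z)`. [cite: Balaban1987RG1, (5.19), (5.26) pp.294–295] -/
theorem F12_flip2 (g : ℝ → ℝ → ℝ → ℝ → ℝ) (z₁ : ℝ) {z₂ : ℝ} (h₂ : z₂ ≠ 0) (z₃ z₄ : ℝ) :
    F12 g z₁ z₂⁻¹ z₃ z₄ = -z₂ * F12 g z₁ z₂ z₃ z₄ := by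
  simp only [F12, inv_inv]; field_simp; ring

/-- (5.19) for (μ, ν) = (1, 2), flipping a variable ∉ {μ, ν}: invariance. [cite: Balaban1987RG1, (5.19), (5.26) pp.294–295] -/
theorem F12_flip3 (g : ℝ → ℝ → ℝ → ℝ → ℝ) (z₁ z₂ z₃ z₄ : ℝ) : F12 g z₁ z₂ z₃⁻¹ z₄ = F12 g z₁ z₂ z₃ z₄ := by
  simp only [F12, inv_inv]; ring

/-- (5.19) for (μ, ν) = (1, 2), flipping the variable 4 ∉ {μ, ν}: invariance. [cite: Balaban1987RG1, (5.19), (5.26) pp.294–295] -/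
theorem F12_flip4 (g : ℝ → ℝ → ℝ → ℝ → ℝ) (z₁ z₂ z₃ z₄ : ℝ) : F12 g z₁ z₂ z₃ z₄⁻¹ = F12 g z₁ z₂ z₃ z₄ := by
  simp only [F12, inv_inv]; ring

/-- "(5.20) are equivalent to (5.28)" (p. 295), the direction (5.28) ⇒ (5.20) for the pair (1,2): if
`g₂₁(z) = z₁⁻¹z₂g₁₂(z)` ((5.28) with (μ,ν) = (2,1)) then `f₁₂(z) = f₂₁(z⁻¹)`, term by term in (5.26). [cite: Balaban1987RG1, (5.20), (5.26), (5.28) pp.294–295] -/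
theorem f12_eq_f21_inv (g₁₂ g₂₁ : ℝ → ℝ → ℝ → ℝ → ℝ)
    (h28 : ∀ y₁ y₂ y₃ y₄ : ℝ, g₂₁ y₁ y₂ y₃ y₄ = y₁⁻¹ * y₂ * g₁₂ y₁ y₂ y₃ y₄)
    {z₁ z₂ : ℝ} (h₁ : z₁ ≠ 0) (h₂ : z₂ ≠ 0) (z₃ z₄ : ℝ) :
    F12 g₁₂ z₁ z₂ z₃ z₄ = F21 g₂₁ z₁⁻¹ z₂⁻¹ z₃⁻¹ z₄⁻¹ := by
  simp only [F12, F21, h28, inv_inv]; field_simp; ring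

/-- (5.40) p. 297: "The representation (5.26) yields `f₁₂(z₁,z₂,1) = 2^{d−2}(z₁z₂⁻¹g₁₂(z₁⁻¹,z₂⁻¹,1) −
z₂⁻¹g₁₂(z₁,z₂⁻¹,1) − z₁g₁₂(z₁⁻¹,z₂,1) + g₁₂(z₁,z₂,1))`" (d = 4: the 2^{d−2} = 4 sign choices in the variables 3, 4
coincide at z₃ = z₄ = 1). [cite: Balaban1987RG1, (5.40) p.297] -/
theorem eq540 (g : ℝ → ℝ → ℝ → ℝ → ℝ) (z₁ z₂ : ℝ) :
    F12 g z₁ z₂ 1 1 = 4 * (z₁ * z₂⁻¹ * g z₁⁻¹ z₂⁻¹ 1 1 - z₂⁻¹ * g z₁ z₂⁻¹ 1 1 - z₁ * g z₁⁻¹ z₂ 1 1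
      + g z₁ z₂ 1 1) := by
  simp only [F12, inv_one]; ring

/-! ## §C. (5.30): the second-order Taylor data of g_{μν} at 1 (d = 4) -/

/-- The data of (5.30) p. 295 for one pair (μ,ν), d = 4: `c = g_{μν}(1)`, `a_κ = a_{μν,κ} = ∂g_{μν}/∂z_κ(1)`,
`b_κλ = b_{μν,κλ} = ∂²g_{μν}/∂z_κ∂z_λ(1)` (symmetric; `b₁₂` is the common value b_{μν,12} = b_{μν,21}). [cite: Balaban1987RG1, (5.30) p.295] -/
structure T2 where
  (c a₁ a₂ a₃ a₄ b₁₁ b₁₂ b₁₃ b₁₄ b₂₂ b₂₃ b₂₄ b₃₃ b₃₄ b₄₄ : ℝ)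

/-- (5.30) without its third-order remainder: `g(y) = c + Σ_κ a_κ(y_κ − 1) + ½Σ_{κ,λ} b_κλ(y_κ − 1)(y_λ − 1)`. [cite: Balaban1987RG1, (5.30) p.295] -/
def T2.g (t : T2) (y₁ y₂ y₃ y₄ : ℝ) : ℝ :=
  t.c + t.a₁ * (y₁ - 1) + t.a₂ * (y₂ - 1) + t.a₃ * (y₃ - 1) + t.a₄ * (y₄ - 1)
  + (t.b₁₁ * (y₁ - 1) ^ 2 + t.b₂₂ * (y₂ - 1) ^ 2 + t.b₃₃ * (y₃ - 1) ^ 2 + t.b₄₄ * (y₄ - 1) ^ 2) / 2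
  + t.b₁₂ * (y₁ - 1) * (y₂ - 1) + t.b₁₃ * (y₁ - 1) * (y₃ - 1) + t.b₁₄ * (y₁ - 1) * (y₄ - 1)
  + t.b₂₃ * (y₂ - 1) * (y₃ - 1) + t.b₂₄ * (y₂ - 1) * (y₄ - 1) + t.b₃₄ * (y₃ - 1) * (y₄ - 1)

/-! ## §D. (5.26) + (5.30) ⇒ (5.33): the exact identities, the printed explicit part, and the slip -/

/-- The fourth-order remainder of f₁₁: `4Σ_κ b_κκ u_κ² + 4Σ_{κ<λ} b_κλ u_κ u_λ`, u_κ = (z_κ⁻¹ − 1)(z_κ − 1). [cite: Balaban1987RG1, (5.33) p.296] -/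
def R11 (t : T2) (z₁ z₂ z₃ z₄ : ℝ) : ℝ :=
  4 * (t.b₁₁ * um z₁ ^ 2 + t.b₂₂ * um z₂ ^ 2 + t.b₃₃ * um z₃ ^ 2 + t.b₄₄ * um z₄ ^ 2)
  + 4 * (t.b₁₂ * um z₁ * um z₂ + t.b₁₃ * um z₁ * um z₃ + t.b₁₄ * um z₁ * um z₄
    + t.b₂₃ * um z₂ * um z₃ + t.b₂₄ * um z₂ * um z₄ + t.b₃₄ * um z₃ * um z₄)

/-- **(5.26) + (5.30) for μ = ν, EXACT** (d = 4): `f₁₁(z) = 16 g₁₁(1) − 8 Σ_κ (a₁₁,κ + b₁₁,κκ)(z_κ⁻¹ − 1)(z_κ − 1)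
+ R₁₁(z)` with the FOURTH-order remainder `R11`.  This is what "substituting the expansion (5.30) into the
representation (5.26)" gives on the diagonal. [cite: Balaban1987RG1, (5.26), (5.30), (5.33) pp.295–296] -/
theorem eq533_diag (t : T2) {z₁ z₂ z₃ z₄ : ℝ} (h₁ : z₁ ≠ 0) (h₂ : z₂ ≠ 0) (h₃ : z₃ ≠ 0) (h₄ : z₄ ≠ 0) :
    F11 t.g z₁ z₂ z₃ z₄ = 16 * t.c
      - 8 * ((t.a₁ + t.b₁₁) * um z₁ + (t.a₂ + t.b₂₂) * um z₂ + (t.a₃ + t.b₃₃) * um z₃ + (t.a₄ + t.b₄₄) * um z₄)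
      + R11 t z₁ z₂ z₃ z₄ := by
  simp only [F11, T2.g, R11, um]; field_simp; ring

/-- The EXPLICITLY WRITTEN (order ≤ 2) part of the printed (5.33) p. 296 at μ = ν = 1, d = 4, verbatim:
`2^{d−2}g₁₁(1)[4 − (z₁⁻¹−1)(z₁−1)] + 2^{d−2}[g₁₁(1) − 2a₁₁,₁ + 2a₁₁,₁ − 4b₁₁,₁₁](z₁⁻¹−1)(z₁−1) −
2^{d−1}[Σ_κ(a₁₁,κ + b₁₁,κκ)(z_κ⁻¹−1)(z_κ−1) − 2(a₁₁,₁ + b₁₁,₁₁)(z₁⁻¹−1)(z₁−1)]`. [cite: Balaban1987RG1, (5.33) p.296] -/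
def printed533diag (t : T2) (z₁ z₂ z₃ z₄ : ℝ) : ℝ :=
  4 * t.c * (4 - (z₁⁻¹ - 1) * (z₁ - 1))
  + 4 * (t.c - 2 * t.a₁ + 2 * t.a₁ - 4 * t.b₁₁) * ((z₁⁻¹ - 1) * (z₁ - 1))
  - 8 * (((t.a₁ + t.b₁₁) * ((z₁⁻¹ - 1) * (z₁ - 1)) + (t.a₂ + t.b₂₂) * ((z₂⁻¹ - 1) * (z₂ - 1))
      + (t.a₃ + t.b₃₃) * ((z₃⁻¹ - 1) * (z₃ - 1)) + (t.a₄ + t.b₄₄) * ((z₄⁻¹ - 1) * (z₄ - 1)))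
      - 2 * (t.a₁ + t.b₁₁) * ((z₁⁻¹ - 1) * (z₁ - 1)))

/-- **The located slip (GAPS G-b12g2-1).**  f₁₁ minus the explicitly written part of the printed (5.33) is NOT of
third order: it equals `−16 a₁₁,₁ (z₁⁻¹ − 1)(z₁ − 1)` (second order) plus the fourth-order `R11`.  I.e. the printed
diagonal block carries a spurious `+2^d a_{μμ,μ}(z_μ⁻¹ − 1)(z_μ − 1)`; the compensating term "−2(a_{μμ,μ} + b_{μμ,μμ})"
in its third line should read "−2b_{μμ,μμ}". [cite: Balaban1987RG1, (5.26), (5.30), (5.33) pp.295–296] -/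
theorem F11_sub_printed533 (t : T2) {z₁ z₂ z₃ z₄ : ℝ} (h₁ : z₁ ≠ 0) (h₂ : z₂ ≠ 0) (h₃ : z₃ ≠ 0) (h₄ : z₄ ≠ 0) :
    F11 t.g z₁ z₂ z₃ z₄ - printed533diag t z₁ z₂ z₃ z₄ = -16 * t.a₁ * um z₁ + R11 t z₁ z₂ z₃ z₄ := by
  simp only [F11, T2.g, R11, printed533diag, um]; field_simp; ring

/-- The corrected explicit part (third line with "−2b_{μμ,μμ}" in place of "−2(a_{μμ,μ} + b_{μμ,μμ})") IS f₁₁ up to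
the fourth-order remainder. [cite: Balaban1987RG1, (5.26), (5.30), (5.33) pp.295–296] -/
theorem eq533_diag_corrected (t : T2) {z₁ z₂ z₃ z₄ : ℝ} (h₁ : z₁ ≠ 0) (h₂ : z₂ ≠ 0) (h₃ : z₃ ≠ 0) (h₄ : z₄ ≠ 0) :
    F11 t.g z₁ z₂ z₃ z₄ =
      4 * t.c * (4 - um z₁) + 4 * (t.c - 2 * t.a₁ + 2 * t.a₁ - 4 * t.b₁₁) * um z₁
      - 8 * (((t.a₁ + t.b₁₁) * um z₁ + (t.a₂ + t.b₂₂) * um z₂ + (t.a₃ + t.b₃₃) * um z₃ + (t.a₄ + t.b₄₄) * um z₄)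
          - 2 * t.b₁₁ * um z₁)
      + R11 t z₁ z₂ z₃ z₄ := by
  simp only [F11, T2.g, R11, um]; field_simp; ring

/-- WITNESS, d = 4: `g₁₁(y) = y₁ − 1` (a₁₁,₁ = 1, all other data 0).  Then `f₁₁(z) = Σ_ε (z₁^{ε₁} − 1) =
8(z₁ + z₁⁻¹ − 2) = −8(z₁⁻¹ − 1)(z₁ − 1)` EXACTLY, whereas the printed explicit part of (5.33) evaluates to
`+8(z₁⁻¹ − 1)(z₁ − 1)`. [cite: Balaban1987RG1, (5.26), (5.33) pp.295–296] -/
theorem printed533_diag_witness {z₁ : ℝ} (h₁ : z₁ ≠ 0) (z₂ z₃ z₄ : ℝ) :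
    F11 (T2.g ⟨0, 1, 0, 0, 0, 0, 0, 0, 0, 0, 0, 0, 0, 0, 0⟩) z₁ z₂ z₃ z₄ = -8 * um z₁ ∧
    printed533diag ⟨0, 1, 0, 0, 0, 0, 0, 0, 0, 0, 0, 0, 0, 0, 0⟩ z₁ z₂ z₃ z₄ = 8 * um z₁ := by
  constructor
  · simp only [F11, T2.g, um]; field_simp; ring
  · simp only [printed533diag, um]; ring

/-- … and their difference `−16(z₁⁻¹ − 1)(z₁ − 1) = 16(z₁ − 1)²/z₁` (put z₁ = 1 + s) is NOT bounded by C|z − 1|³ near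
z = 1: it is a genuine second-order discrepancy, not one of "the dots" of (5.33). [folklore] -/
theorem defect_not_third_order :
    ¬ ∃ C δ : ℝ, 0 < δ ∧ ∀ s : ℝ, |s| < δ → |16 * s ^ 2 / (1 + s)| ≤ C * |s| ^ 3 := by
  rintro ⟨C, δ, hδ, h⟩
  set s : ℝ := min (δ / 2) (min 1 (4 / (|C| + 1))) with hs_def
  have hC1 : 0 < |C| + 1 := by positivity
  have hs_pos : 0 < s := by
    simp only [hs_def, lt_min_iff]; exact ⟨by linarith, by norm_num, by positivity⟩
  have hs_le_δ : s ≤ δ / 2 := min_le_left _ _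
  have hs_le_1 : s ≤ 1 := le_trans (min_le_right _ _) (min_le_left _ _)
  have hs_le_C : s ≤ 4 / (|C| + 1) := le_trans (min_le_right _ _) (min_le_right _ _)
  have habs : |s| = s := abs_of_pos hs_pos
  have h1 := h s (by rw [habs]; linarith)
  rw [habs, abs_of_pos (by positivity : 0 < 16 * s ^ 2 / (1 + s))] at h1
  -- 16 s²/(1+s) ≥ 8 s² since 1 + s ≤ 2
  have h2 : 8 * s ^ 2 ≤ 16 * s ^ 2 / (1 + s) := by
    rw [le_div_iff₀ (by linarith)]; nlinarith
  have h3 : 8 * s ^ 2 ≤ C * s ^ 3 := le_trans h2 h1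
  -- divide by s² > 0: 8 ≤ C s ≤ |C| s ≤ |C|·4/(|C|+1) < 4
  have h4 : 8 ≤ C * s := by
    have : 0 < s ^ 2 := by positivity
    nlinarith
  have h5 : C * s ≤ |C| * s := by gcongr; exact le_abs_self C
  have h6 : |C| * s ≤ |C| * (4 / (|C| + 1)) := by gcongr
  have h7 : |C| * (4 / (|C| + 1)) < 4 := by
    rw [mul_div_assoc', div_lt_iff₀ hC1]; nlinarith [abs_nonneg C]
  linarith

/-- The third-order remainder of f₁₂ (each summand carries ≥ 3 factors from {z_κ − 1, z_κ⁻¹ − 1}; u_κ counts two). [cite: Balaban1987RG1, (5.33) p.296] -/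
def R12 (t : T2) (z₁ z₂ z₃ z₄ : ℝ) : ℝ :=
  (4 * t.c - 8 * t.a₁) * ((z₁ - 1) * (z₂ - 1) * ((z₂ - 1) - (z₁ - 1)) * z₁⁻¹ * z₂⁻¹)
  + (8 * t.b₁₂ - 4 * t.a₂) * ((z₁ - 1) * (z₂ - 1) * ((z₂⁻¹ - 1) * (z₂⁻¹ + 1) - 2 * (z₁⁻¹ - 1)))
  + (-2 * t.a₃ * um z₃ - 2 * t.a₄ * um z₄ + t.b₃₃ * (um z₃ ^ 2 - 2 * um z₃) + t.b₄₄ * (um z₄ ^ 2 - 2 * um z₄)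
      + 4 * t.b₁₃ * um z₃ + 4 * t.b₁₄ * um z₄ + t.b₃₄ * um z₃ * um z₄) * ((z₁ - 1) * (z₂⁻¹ - 1))
  + (2 * t.b₂₃ * um z₃ + 2 * t.b₂₄ * um z₄) * ((z₁ - 1) * (z₂ - 1) * (1 + z₂⁻¹ ^ 2))
  - 2 * t.b₁₁ * ((z₁ - 1) ^ 3 * z₁⁻¹ * (z₂⁻¹ - 1))
  - 2 * t.b₂₂ * ((z₁ - 1) * (z₂ - 1) ^ 2 * (1 - z₂⁻¹ ^ 3))

/-- (5.26) + (5.30) for (μ,ν) = (1,2), EXACT closed form (d = 4), organised by the one-variable operators: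
`f₁₂ = [4c − 8a₁ + (2nd-order in u₃,u₄)]·(z₁−1)(z₂⁻¹−1) + [−4a₂ + 8b₁₂ + 2b₂₃u₃ + 2b₂₄u₄]·(z₁−1)(z₂−1)(1 + z₂⁻²)
− 2b₁₁(z₁−1)³z₁⁻¹(z₂⁻¹−1) − 2b₂₂(z₁−1)(z₂−1)²(1 − z₂⁻³)`. [cite: Balaban1987RG1, (5.26), (5.30) p.295] -/
theorem F12_quad (t : T2) {z₁ z₂ z₃ z₄ : ℝ} (h₁ : z₁ ≠ 0) (h₂ : z₂ ≠ 0) (h₃ : z₃ ≠ 0) (h₄ : z₄ ≠ 0) :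
    F12 t.g z₁ z₂ z₃ z₄ =
      (4 * t.c - 8 * t.a₁ - 2 * t.a₃ * um z₃ - 2 * t.a₄ * um z₄ + t.b₃₃ * (um z₃ ^ 2 - 2 * um z₃)
          + t.b₄₄ * (um z₄ ^ 2 - 2 * um z₄) + 4 * t.b₁₃ * um z₃ + 4 * t.b₁₄ * um z₄ + t.b₃₄ * um z₃ * um z₄)
        * ((z₁ - 1) * (z₂⁻¹ - 1))
      + (-4 * t.a₂ + 8 * t.b₁₂ + 2 * t.b₂₃ * um z₃ + 2 * t.b₂₄ * um z₄) * ((z₁ - 1) * (z₂ - 1) * (1 + z₂⁻¹ ^ 2))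
      - 2 * t.b₁₁ * ((z₁ - 1) ^ 3 * z₁⁻¹ * (z₂⁻¹ - 1))
      - 2 * t.b₂₂ * ((z₁ - 1) * (z₂ - 1) ^ 2 * (1 - z₂⁻¹ ^ 3)) := by
  simp only [F12, T2.g, um]; field_simp; ring

/-- **(5.33), OFF-DIAGONAL block, CERTIFIED** (d = 4, (μ,ν) = (1,2)): `f₁₂(z) = 2^{d−2}[g₁₂(1) − 2a₁₂,₁ + 2a₁₂,₂ −
4b₁₂,₁₂](z₁⁻¹ − 1)(z₂ − 1) + R₁₂(z)` with the third-order remainder `R12` — exactly the printed second line.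
[cite: Balaban1987RG1, (5.33) p.296] -/
theorem eq533_offdiag (t : T2) {z₁ z₂ z₃ z₄ : ℝ} (h₁ : z₁ ≠ 0) (h₂ : z₂ ≠ 0) (h₃ : z₃ ≠ 0) (h₄ : z₄ ≠ 0) :
    F12 t.g z₁ z₂ z₃ z₄ =
      4 * (t.c - 2 * t.a₁ + 2 * t.a₂ - 4 * t.b₁₂) * ((z₁⁻¹ - 1) * (z₂ - 1)) + R12 t z₁ z₂ z₃ z₄ := by
  simp only [F12, T2.g, R12, um]; field_simp; ring

/-- **(5.41) p. 297, algebraic form**: `f₁₂(z₁,z₂,1,1) = (z₁ − 1)(z₂ − 1)·ψ(z₁,z₂)` with the Laurent polynomial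
`ψ(z₁,z₂) = −(4c − 8a₁)z₂⁻¹ + (8b₁₂ − 4a₂)(1 + z₂⁻²) + 2b₁₁(z₁ − 1)²z₁⁻¹z₂⁻¹ − 2b₂₂(z₂ − 1)(1 − z₂⁻³)`, whence (product
rule) `∂²f₁₂/∂z₁∂z₂(1,1) = ψ(1,1) = 4(−g₁₂(1) + 2a₁₂,₁ − 2a₁₂,₂ + 4b₁₂,₁₂)` = (5.41) = (5.39) = β (the
derivative statement itself is `eq541_deriv`). [cite: Balaban1987RG1, (5.40)–(5.41) p.297] -/
def psi541 (t : T2) (z₁ z₂ : ℝ) : ℝ :=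
  -(4 * t.c - 8 * t.a₁) * z₂⁻¹ + (8 * t.b₁₂ - 4 * t.a₂) * (1 + z₂⁻¹ ^ 2)
  + 2 * t.b₁₁ * (z₁ - 1) ^ 2 * z₁⁻¹ * z₂⁻¹ - 2 * t.b₂₂ * (z₂ - 1) * (1 - z₂⁻¹ ^ 3)

/-- (5.40)–(5.41) p. 297, exact factorisation `f₁₂(z₁,z₂,1,1) = (z₁ − 1)(z₂ − 1)ψ(z₁,z₂)` and `ψ(1,1) = 4(−g₁₂(1) +
2a₁₂,₁ − 2a₁₂,₂ + 4b₁₂,₁₂)`. [cite: Balaban1987RG1, (5.40)–(5.41) p.297] -/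
theorem eq541_factor (t : T2) {z₁ z₂ : ℝ} (h₁ : z₁ ≠ 0) (h₂ : z₂ ≠ 0) :
    F12 t.g z₁ z₂ 1 1 = (z₁ - 1) * (z₂ - 1) * psi541 t z₁ z₂ ∧
    psi541 t 1 1 = 4 * (-t.c + 2 * t.a₁ - 2 * t.a₂ + 4 * t.b₁₂) := by
  constructor
  · simp only [F12, T2.g, psi541, inv_one]; field_simp; ring
  · simp only [psi541, inv_one]; ring

/-- **(5.41) VERBATIM** ("Differentiating it with respect to z₁, z₂, at z₁ = z₂ = 1, we obtain (∂²f₁₂/∂z₁∂z₂)(1) =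
2^{d−2}(−g₁₂(1) + 2a₁₂,₁ − 2a₁₂,₂ + 4b₁₂,₁₂) = β"), for the quadratic Taylor data of g₁₂ (the third-order remainder
of (5.30) does not contribute to second derivatives at 1), d = 4. [cite: Balaban1987RG1, (5.41) p.297] -/
theorem eq541_deriv (t : T2) :
    deriv (fun z₁ : ℝ => deriv (fun z₂ : ℝ => F12 t.g z₁ z₂ 1 1) 1) 1
      = 4 * (-t.c + 2 * t.a₁ - 2 * t.a₂ + 4 * t.b₁₂) := by
  -- the inner derivative, for z₁ ≠ 0: ∂/∂z₂|₁ [(z₁ − 1)(z₂ − 1)ψ(z₁,z₂)] = (z₁ − 1)ψ(z₁,1)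
  have hinner : ∀ z₁ : ℝ, z₁ ≠ 0 →
      deriv (fun z₂ : ℝ => F12 t.g z₁ z₂ 1 1) 1 = (z₁ - 1) * psi541 t z₁ 1 := by
    intro z₁ hz₁
    have hev : (fun z₂ : ℝ => F12 t.g z₁ z₂ 1 1) =ᶠ[nhds 1]
        fun z₂ => (z₂ - 1) * ((z₁ - 1) * psi541 t z₁ z₂) :=
      (eventually_ne_nhds (one_ne_zero : (1 : ℝ) ≠ 0)).mono fun z₂ hz₂ => by
        beta_reduce; rw [(eq541_factor t hz₁ hz₂).1]; ring
    have hk : DifferentiableAt ℝ (fun z₂ : ℝ => (z₁ - 1) * psi541 t z₁ z₂) 1 := by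
      unfold psi541; fun_prop (disch := norm_num)
    have h1 : DifferentiableAt ℝ (fun z₂ : ℝ => z₂ - 1) 1 := by fun_prop
    rw [hev.deriv_eq, deriv_fun_mul h1 hk]
    simp
  have hev : (fun z₁ : ℝ => deriv (fun z₂ : ℝ => F12 t.g z₁ z₂ 1 1) 1) =ᶠ[nhds 1]
      fun z₁ => (z₁ - 1) * psi541 t z₁ 1 :=
    (eventually_ne_nhds (one_ne_zero : (1 : ℝ) ≠ 0)).mono fun z₁ hz₁ => hinner z₁ hz₁
  have hk : DifferentiableAt ℝ (fun z₁ : ℝ => psi541 t z₁ 1) 1 := by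
    unfold psi541; fun_prop (disch := norm_num)
  have h1 : DifferentiableAt ℝ (fun z₁ : ℝ => z₁ - 1) 1 := by fun_prop
  rw [hev.deriv_eq, deriv_fun_mul h1 hk, (eq541_factor t (one_ne_zero : (1 : ℝ) ≠ 0) one_ne_zero).2]
  simp

/-! ## §E. (5.21) ⇒ (5.34): the third-order coefficients of `Σ_ν (z_ν − 1) f_{1ν}(z)` (d = 4, μ = 1)

With w = z − 1 one has `(z_κ⁻¹ − 1)(z_κ − 1) = −w_κ² + O(w³)` and `(z₁⁻¹ − 1)(z_ν − 1) = −w₁w_ν + O(w³)`, so by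
`eq533_diag` / `eq533_offdiag` (and their images under (5.27)) the jets of order ≤ 2 at z = 1 are
`J f₁₁(w) = 16c₁₁ + 8Σ_κ A_κ w_κ²`, `A_κ := a₁₁,κ + b₁₁,κκ`, and `J f₁ν(w) = 4K_ν w₁w_ν` (ν ≠ 1),
`K_ν := −g₁ν(1) + 2a₁ν,₁ − 2a₁ν,ν + 4b₁ν,₁ν` (= β₁ν of (5.35), = minus the left-hand side of (5.34)).  The terms of
order ≤ 3 of the analytic function `Σ_ν (z_ν − 1)f₁ν(z)` ("identically equal to 0", p. 296) are therefore the cubic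
`W(w) = w₁·J f₁₁(w) + Σ_{ν≠1} w_ν·J f₁ν(w)`, and (5.34) is the statement that W ≡ 0 as a polynomial. -/

/-- **(5.34), from the TRUE jets**: `W ≡ 0` iff `g₁₁(1) = 0`, `a₁₁,₁ + b₁₁,₁₁ = 0` (the diagonal equation), and, for
ν = 2, 3, 4, `K_ν = −2A_ν`, i.e. VERBATIM (5.34)₁: `g₁ν(1) − 2a₁ν,₁ + 2a₁ν,ν − 4b₁ν,₁ν = 2(a₁₁,ν + b₁₁,νν)`.  The
printed diagonal equation (5.34)₂, `g₁₁(1) − 2a₁₁,₁ + 2a₁₁,₁ − 4b₁₁,₁₁ = −2(a₁₁,₁ + b₁₁,₁₁)`, reads instead a₁₁,₁ =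
b₁₁,₁₁ (given g₁₁(1) = 0) — see `ward534_printed` and §I. [cite: Balaban1987RG1, (5.34) p.296] -/
theorem ward534 (c A₁ A₂ A₃ A₄ K₂ K₃ K₄ : ℝ) :
    (∀ w₁ w₂ w₃ w₄ : ℝ, w₁ * (16 * c + 8 * (A₁ * w₁ ^ 2 + A₂ * w₂ ^ 2 + A₃ * w₃ ^ 2 + A₄ * w₄ ^ 2))
        + w₂ * (4 * K₂ * w₁ * w₂) + w₃ * (4 * K₃ * w₁ * w₃) + w₄ * (4 * K₄ * w₁ * w₄) = 0) ↔
    (c = 0 ∧ A₁ = 0 ∧ K₂ = -2 * A₂ ∧ K₃ = -2 * A₃ ∧ K₄ = -2 * A₄) := by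
  constructor
  · intro h
    have e1 := h 1 0 0 0
    have e2 := h 2 0 0 0
    have e3 := h 1 1 0 0
    have e4 := h 1 0 1 0
    have e5 := h 1 0 0 1
    norm_num at e1 e2 e3 e4 e5
    refine ⟨by linarith, by linarith, by linarith, by linarith, by linarith⟩
  · rintro ⟨rfl, rfl, rfl, rfl, rfl⟩ w₁ w₂ w₃ w₄
    ring

/-- The same computation on the PRINTED explicit part of (5.33) (`printed533diag`, jet `16c + 8Σ_κA_κw_κ² − 16a₁₁,₁w₁²`
by `F11_sub_printed533`) reproduces the PRINTED system (5.34) including (5.34)₂ (`c − 4b = −2(a + b)`, i.e. a₁₁,₁ =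
b₁₁,₁₁ given c = 0): the paper is internally consistent from (5.33) on; the slip sits in (5.33) alone. [cite: Balaban1987RG1, (5.33)–(5.34) p.296] -/
theorem ward534_printed (c a₁ b₁₁ A₂ A₃ A₄ K₂ K₃ K₄ : ℝ) :
    (∀ w₁ w₂ w₃ w₄ : ℝ,
        w₁ * (16 * c + 8 * ((a₁ + b₁₁) * w₁ ^ 2 + A₂ * w₂ ^ 2 + A₃ * w₃ ^ 2 + A₄ * w₄ ^ 2) - 16 * a₁ * w₁ ^ 2)
        + w₂ * (4 * K₂ * w₁ * w₂) + w₃ * (4 * K₃ * w₁ * w₃) + w₄ * (4 * K₄ * w₁ * w₄) = 0) ↔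
    (c = 0 ∧ c - 4 * b₁₁ = -2 * (a₁ + b₁₁) ∧ K₂ = -2 * A₂ ∧ K₃ = -2 * A₃ ∧ K₄ = -2 * A₄) := by
  constructor
  · intro h
    have e1 := h 1 0 0 0
    have e2 := h 2 0 0 0
    have e3 := h 1 1 0 0
    have e4 := h 1 0 1 0
    have e5 := h 1 0 0 1
    norm_num at e1 e2 e3 e4 e5
    refine ⟨by linarith, by linarith, by linarith, by linarith, by linarith⟩
  · rintro ⟨rfl, h2, rfl, rfl, rfl⟩ w₁ w₂ w₃ w₄
    have hb : b₁₁ = a₁ := by linarith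
    subst hb; ring

/-! ## §F. (5.34) ⇒ (5.35) ⇒ (5.36): β_{μμ} drops out; (5.36) for the pairs (1,1), (1,2) with β = (5.39) -/

/-- **(5.35) on the diagonal, for ANY value of β₁₁.**  By `eq533_diag` the second-order part of f₁₁ is
`−8Σ_κ A_κ u_κ` (u_κ = (z_κ⁻¹−1)(z_κ−1), g₁₁(1) = 0); on the Ward solutions (`ward534`: A₁ = 0, A_κ = −K_κ/2 = −β₁κ/2
for κ ≠ 1) this is `4Σ_{κ≠1} β₁κ u_κ = −2^{d−2}β₁₁u₁ + 2^{d−2}Σ_κ β₁κ u_κ` = the printed (5.35), WHATEVER number is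
called β₁₁ (the paper's β₁₁ := −(g₁₁(1) − 4b₁₁,₁₁) included). [cite: Balaban1987RG1, (5.35) p.296] -/
theorem eq535_diag_coeff (A₁ A₂ A₃ A₄ K₂ K₃ K₄ β₁₁ : ℝ) (hA : A₁ = 0) (h₂ : K₂ = -2 * A₂) (h₃ : K₃ = -2 * A₃)
    (h₄ : K₄ = -2 * A₄) (u₁ u₂ u₃ u₄ : ℝ) :
    -8 * (A₁ * u₁ + A₂ * u₂ + A₃ * u₃ + A₄ * u₄) =
      -4 * β₁₁ * u₁ + 4 * (β₁₁ * u₁ + K₂ * u₂ + K₃ * u₃ + K₄ * u₄) := by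
  subst hA h₂ h₃ h₄; ring

/-- **(5.36) = (5.37) for the pair (1,1), d = 4, EXACT.**  If the data of g₁₁ satisfy the Ward equations (g₁₁(1) = 0,
a₁₁,₁ + b₁₁,₁₁ = 0, and a₁₁,κ + b₁₁,κκ = −β′/2 for κ = 2,3,4 — (5.34)₁ with all β₁κ, κ ≠ 1, equal to β′ by (5.32)),
then `f₁₁(z) = β·Σ_{κ≠1}(z_κ⁻¹ − 1)(z_κ − 1) + R₁₁(z) = β(δ₁₁Σ_κ u_κ − (z₁⁻¹ − 1)(z₁ − 1)) + R₁₁(z)` with β = 4β′ =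
2^{d−2}β₁₂. [cite: Balaban1987RG1, (5.36) p.297] -/
theorem eq536_11 (t : T2) (β' : ℝ) (hc : t.c = 0) (h1 : t.a₁ + t.b₁₁ = 0) (h2 : t.a₂ + t.b₂₂ = -β' / 2)
    (h3 : t.a₃ + t.b₃₃ = -β' / 2) (h4 : t.a₄ + t.b₄₄ = -β' / 2)
    {z₁ z₂ z₃ z₄ : ℝ} (hz₁ : z₁ ≠ 0) (hz₂ : z₂ ≠ 0) (hz₃ : z₃ ≠ 0) (hz₄ : z₄ ≠ 0) :
    F11 t.g z₁ z₂ z₃ z₄ =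
      4 * β' * ((um z₁ + um z₂ + um z₃ + um z₄) - (z₁⁻¹ - 1) * (z₁ - 1)) + R11 t z₁ z₂ z₃ z₄ := by
  rw [eq533_diag t hz₁ hz₂ hz₃ hz₄, hc, h1, h2, h3, h4]; simp only [um]; ring

/-- **(5.36) = (5.37) for the pair (1,2), d = 4, EXACT**: with β₁₂ := −(g₁₂(1) − 2a₁₂,₁ + 2a₁₂,₂ − 4b₁₂,₁₂) = β′,
`f₁₂(z) = −4β′(z₁⁻¹ − 1)(z₂ − 1) + R₁₂(z) = β(δ₁₂Σ_κu_κ − (z₁⁻¹ − 1)(z₂ − 1)) + R₁₂(z)`, β = 4β′ = (5.39).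
[cite: Balaban1987RG1, (5.36), (5.39) p.297] -/
theorem eq536_12 (t : T2) (β' : ℝ) (hβ : -(t.c - 2 * t.a₁ + 2 * t.a₂ - 4 * t.b₁₂) = β')
    {z₁ z₂ z₃ z₄ : ℝ} (hz₁ : z₁ ≠ 0) (hz₂ : z₂ ≠ 0) (hz₃ : z₃ ≠ 0) (hz₄ : z₄ ≠ 0) :
    F12 t.g z₁ z₂ z₃ z₄ = -(4 * β') * ((z₁⁻¹ - 1) * (z₂ - 1)) + R12 t z₁ z₂ z₃ z₄ := by
  rw [eq533_offdiag t hz₁ hz₂ hz₃ hz₄, ← hβ]; ring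

/-! ## §H. The structural content in general dimension d: parity shape + Ward identity ⇒ transverse jet -/

/-- The hypercubic-parity SHAPE of the second-order jets at z = 1 forced by (5.26) (cf. `eq533_diag`,
`eq533_offdiag`; w = z − 1): `J f_{μμ}(w) = Σ_κ D_{μκ} w_κ²` (no mixed monomials, no linear term; the constant
g_{μμ}(1) = 0 removed) and, for μ ≠ ν, `J f_{μν}(w) = C_{μν} w_μ w_ν` (d = 4: D_{μκ} = 8(a_{μμ,κ} + b_{μμ,κκ}),
C_{μν} = 4β_{μν}). [cite: Balaban1987RG1, (5.33)–(5.36) pp.296–297] -/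
def jetQ {d : ℕ} (C D : Fin d → Fin d → ℝ) (μ ν : Fin d) (w : Fin d → ℝ) : ℝ :=
  if μ = ν then ∑ κ, D μ κ * w κ ^ 2 else C μ ν * w μ * w ν

/-- **Ward ⇒ (5.34) in general d.**  If the cubic `Σ_ν w_ν · J f_{μν}(w)` (the order-3 part of Σ_ν(z_ν − 1)f_{μν}(z),
(5.21)) vanishes identically for every μ, then `D_{μμ} = 0` (the diagonal equation: NO (z_μ⁻¹−1)(z_μ−1) term in
f_{μμ}) and `C_{μν} = −D_{μν}` for μ ≠ ν (this is (5.34)₁: 4β_{μν} = −8(a_{μμ,ν} + b_{μμ,νν})). [cite: Balaban1987RG1, (5.21) p.294, (5.34) p.296] -/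
theorem transverse_of_ward {d : ℕ} (C D : Fin d → Fin d → ℝ)
    (hW : ∀ (μ : Fin d) (w : Fin d → ℝ), ∑ ν, w ν * jetQ C D μ ν w = 0) :
    (∀ μ, D μ μ = 0) ∧ ∀ μ ν, μ ≠ ν → C μ ν = -D μ ν := by
  have hdiag : ∀ μ, D μ μ = 0 := by
    intro μ
    have h := hW μ (Pi.single μ 1)
    rw [Fintype.sum_eq_single μ (fun ν hν => by simp [hν])] at h
    simp only [jetQ, if_true, Pi.single_eq_same, one_mul] at h
    rw [Fintype.sum_eq_single μ (fun κ hκ => by simp [hκ])] at h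
    simpa using h
  refine ⟨hdiag, fun μ ν hne => ?_⟩
  -- evaluate at w = e_μ + e_ν
  set w : Fin d → ℝ := fun κ => if κ = μ then 1 else if κ = ν then 1 else 0 with hw
  have hwμ : w μ = 1 := by simp [hw]
  have hwν : w ν = 1 := by simp [hw, hne.symm]
  have hw0 : ∀ κ, κ ≠ μ → κ ≠ ν → w κ = 0 := fun κ h1 h2 => by simp [hw, h1, h2]
  have h := hW μ w
  rw [Fintype.sum_eq_add μ ν hne (fun κ hκ => by rw [hw0 κ hκ.1 hκ.2, zero_mul])] at h
  have hQμμ : jetQ C D μ μ w = D μ μ + D μ ν := by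
    simp only [jetQ, if_true]
    rw [Fintype.sum_eq_add μ ν hne (fun κ hκ => by rw [hw0 κ hκ.1 hκ.2]; ring), hwμ, hwν]; ring
  have hQμν : jetQ C D μ ν w = C μ ν := by
    simp only [jetQ, if_neg hne, hwμ, hwν]; ring
  rw [hQμμ, hQμν, hwμ, hwν, hdiag μ] at h
  linarith

/-- **(5.36)/(5.37): the transverse jet.**  Parity shape + Ward identity + "all the coefficients β_{μν} for μ ≠ ν are
equal" (p. 296, from (5.32)) force `J f_{μν}(w) = β(w_μ w_ν − δ_{μν}|w|²)` — with (z_κ⁻¹−1)(z_κ−1) ≡ −w_κ² and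
(z_μ⁻¹−1)(z_ν−1) ≡ −w_μw_ν this is VERBATIM (5.36) `β(δ_{μν}Σ_κ(z_κ⁻¹−1)(z_κ−1) − (z_μ⁻¹−1)(z_ν−1))`, and with
z_κ = e^{ip_κ} it is (5.37) `β(δ_{μν}Δ(p) − ∂̄_μ(p)∂_ν(p))`: the marginal part of the vacuum polarization is β times
the quadratic form of the linearised Wilson action — a coupling-constant renormalization and nothing else.
[cite: Balaban1987RG1, (5.36)–(5.37) p.297] -/
theorem transverse_jet {d : ℕ} (C D : Fin d → Fin d → ℝ) (β : ℝ)
    (hW : ∀ (μ : Fin d) (w : Fin d → ℝ), ∑ ν, w ν * jetQ C D μ ν w = 0)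
    (hsym : ∀ μ ν, μ ≠ ν → C μ ν = β) (μ ν : Fin d) (w : Fin d → ℝ) :
    jetQ C D μ ν w = β * (w μ * w ν - if μ = ν then ∑ κ, w κ ^ 2 else 0) := by
  obtain ⟨hdiag, hoff⟩ := transverse_of_ward C D hW
  by_cases h : μ = ν
  · subst h
    simp only [jetQ, if_true]
    have hD : ∀ κ, D μ κ = if κ = μ then 0 else -β := by
      intro κ
      by_cases hκ : κ = μ
      · simp [hκ, hdiag]
      · have := hoff μ κ (Ne.symm hκ); rw [hsym μ κ (Ne.symm hκ)] at this
        simp [hκ]; linarith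
    simp_rw [hD]
    rw [show (∑ κ, (if κ = μ then (0:ℝ) else -β) * w κ ^ 2) = ∑ κ, (-β * w κ ^ 2 + if κ = μ then β * w κ ^ 2 else 0)
      from Finset.sum_congr rfl fun κ _ => by split_ifs <;> ring]
    rw [Finset.sum_add_distrib, Finset.sum_ite_eq' Finset.univ μ, ← Finset.mul_sum]
    simp; ring
  · simp only [jetQ, if_neg h, hsym μ ν h]; ring

/-! ## §I. Why the printed lines are nevertheless TRUE for the functions at hand: g_{μμ} vanishes on the μ-axis

(5.21) at the points z = (1,…,1,z_μ,1,…,1) of the polyring reads `(z_μ − 1)f_{μμ}(z) = 0` (all other z_ν − 1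
vanish), and (5.26) there reads `f_{μμ} = 2^{d−1}(φ(z_μ) + φ(z_μ⁻¹))`, φ(ζ) := g_{μμ}(1,…,ζ,…,1), φ analytic on the disc
|ζ| < e^{δ₁} ((5.22)), e^{δ₁} > 1.  Hence φ(ζ) = −φ(ζ⁻¹) for ζ ≠ 1 on the ring, and such a φ is identically zero
(glue φ on the disc with −φ(1/·) outside: an entire bounded function, constant by Liouville, and odd at ζ = −1).  So
EVERY pure z_μ-derivative of g_{μμ} at 1 vanishes: g_{μμ}(1) = 0 (the paper's remark), a_{μμ,μ} = 0 and b_{μμ,μμ} = 0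
— the spurious term 2^d a_{μμ,μ}(…) of the printed (5.33) is zero for the actual g_{μμ}, and the printed (5.34)₂ and
the corrected diagonal equation both hold as 0 = 0. -/

open Metric in
/-- A function holomorphic on the disc |ζ| < R, R > 1, with φ(ζ) + φ(ζ⁻¹) = 0 for ζ ≠ 1 in the ring R⁻¹ < |ζ| < R,
vanishes identically on the disc (Liouville). [folklore] -/
theorem vanish_of_odd_under_inversion {R : ℝ} (hR : 1 < R) (φ : ℂ → ℂ)
    (hφ : DifferentiableOn ℂ φ (ball 0 R))
    (hodd : ∀ z : ℂ, z ≠ 1 → R⁻¹ < ‖z‖ → ‖z‖ < R → φ z + φ z⁻¹ = 0) :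
    ∀ z ∈ ball (0 : ℂ) R, φ z = 0 := by
  have hR0 : 0 < R := by linarith
  have hRinv : R⁻¹ < 1 := inv_lt_one_of_one_lt₀ hR
  -- the glued function
  set Φ : ℂ → ℂ := fun z => if ‖z‖ ≤ 1 then φ z else -φ z⁻¹ with hΦ
  -- Φ = φ on the disc of radius R
  have hΦφ : ∀ z : ℂ, ‖z‖ < R → Φ z = φ z := by
    intro z hz
    by_cases h1 : ‖z‖ ≤ 1
    · simp [hΦ, h1]
    · push Not at h1
      have hz1 : z ≠ 1 := by intro h; rw [h] at h1; simp at h1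
      have := hodd z hz1 (by linarith) hz
      simp only [hΦ, not_le.mpr h1, if_false]
      linear_combination -this
  -- Φ = -φ(1/·) outside the closed unit disc
  have hΦψ : ∀ z : ℂ, 1 < ‖z‖ → Φ z = -φ z⁻¹ := by
    intro z hz; simp [hΦ, not_le.mpr hz]
  -- Φ is entire
  have hdiff : Differentiable ℂ Φ := by
    intro z
    by_cases hz : ‖z‖ < R
    · have hφz : DifferentiableAt ℂ φ z :=
        hφ.differentiableAt (isOpen_ball.mem_nhds (by simpa using hz))
      refine hφz.congr_of_eventuallyEq ?_
      have hev : ∀ᶠ w in nhds z, ‖w‖ < R := (isOpen_lt continuous_norm continuous_const).mem_nhds hz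
      exact hev.mono fun w hw => hΦφ w hw
    · push Not at hz
      have hz1 : 1 < ‖z‖ := lt_of_lt_of_le hR hz
      have hz0 : z ≠ 0 := by intro h; rw [h] at hz1; simp at hz1; linarith
      have hzi : ‖z⁻¹‖ < R := by
        rw [norm_inv]
        calc ‖z‖⁻¹ ≤ R⁻¹ := inv_anti₀ hR0 hz
          _ < R := by linarith
      have hφzi : DifferentiableAt ℂ φ z⁻¹ :=
        hφ.differentiableAt (isOpen_ball.mem_nhds (by simpa using hzi))
      have hinv : DifferentiableAt ℂ (fun w : ℂ => w⁻¹) z := (differentiableAt_id).inv hz0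
      have hcomp : DifferentiableAt ℂ (fun w : ℂ => -φ w⁻¹) z := (hφzi.comp z hinv).neg
      refine hcomp.congr_of_eventuallyEq ?_
      have hev : ∀ᶠ w in nhds z, 1 < ‖w‖ := (isOpen_lt continuous_const continuous_norm).mem_nhds hz1
      exact hev.mono fun w hw => hΦψ w hw
  -- Φ is bounded
  have hsub : closedBall (0 : ℂ) 1 ⊆ ball 0 R := closedBall_subset_ball hR
  obtain ⟨M, hM⟩ := (isCompact_closedBall (0 : ℂ) 1).exists_bound_of_continuousOn (hφ.continuousOn.mono hsub)
  have hbdd : Bornology.IsBounded (Set.range Φ) := by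
    rw [isBounded_iff_forall_norm_le]
    refine ⟨M, ?_⟩
    rintro _ ⟨z, rfl⟩
    by_cases h1 : ‖z‖ ≤ 1
    · rw [show Φ z = φ z by simp [hΦ, h1]]
      exact hM z (by simpa using h1)
    · push Not at h1
      rw [hΦψ z h1, norm_neg]
      refine hM _ ?_
      simp only [mem_closedBall, dist_zero_right, norm_inv]
      exact inv_le_one_of_one_le₀ h1.le
  -- Liouville: Φ is constant, and Φ(−1) = φ(−1) = 0 by oddness at ζ = −1
  have hconst := hdiff.apply_eq_apply_of_bounded hbdd
  have hm1 : φ (-1) = 0 := by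
    have h := hodd (-1) (by norm_num) (by simpa using hRinv) (by simpa using hR)
    have : ((-1 : ℂ))⁻¹ = -1 := by norm_num
    rw [this] at h
    linear_combination h / 2
  intro z hz
  have hzR : ‖z‖ < R := by simpa using hz
  rw [← hΦφ z hzR, hconst z (-1), hΦφ (-1) (by simpa using hR), hm1]

open Metric in
/-- **g_{μμ} vanishes on the μ-axis** (the setting of §I, one complex variable ζ = z_μ, R = e^{δ₁} > 1): from the Ward
identity on the axis `(ζ − 1)F(ζ) = 0` ((5.21)), the representation `F(ζ) = 2^{d−1}(φ(ζ) + φ(ζ⁻¹))` ((5.26)) and the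
analyticity of φ = g_{μμ}(1,…,ζ,…,1) on the disc ((5.22)), φ ≡ 0 on the disc; in particular φ(1) = φ′(1) = φ″(1) = 0,
i.e. `g_{μμ}(1) = a_{μμ,μ} = b_{μμ,μμ} = 0`. [cite: Balaban1987RG1, (5.21)–(5.22) p.294, (5.26) p.295, p.296] -/
theorem gdiag_axis_vanishes {R : ℝ} (hR : 1 < R) (d : ℕ) (F φ : ℂ → ℂ)
    (hφ : DifferentiableOn ℂ φ (ball 0 R))
    (hward : ∀ ζ : ℂ, R⁻¹ < ‖ζ‖ → ‖ζ‖ < R → (ζ - 1) * F ζ = 0)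
    (hrep : ∀ ζ : ℂ, R⁻¹ < ‖ζ‖ → ‖ζ‖ < R → F ζ = 2 ^ (d - 1) * (φ ζ + φ ζ⁻¹)) :
    (∀ ζ ∈ ball (0 : ℂ) R, φ ζ = 0) ∧ φ 1 = 0 ∧ deriv φ 1 = 0 ∧ deriv (deriv φ) 1 = 0 := by
  have hodd : ∀ z : ℂ, z ≠ 1 → R⁻¹ < ‖z‖ → ‖z‖ < R → φ z + φ z⁻¹ = 0 := by
    intro z hz1 hlo hhi
    have h1 := hward z hlo hhi
    rw [hrep z hlo hhi] at h1
    have hz : (z - 1) ≠ 0 := sub_ne_zero.mpr hz1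
    have h2 : (2 : ℂ) ^ (d - 1) ≠ 0 := pow_ne_zero _ two_ne_zero
    rcases mul_eq_zero.mp h1 with h | h
    · exact absurd h hz
    · rcases mul_eq_zero.mp h with h' | h'
      · exact absurd h' h2
      · exact h'
  have hzero := vanish_of_odd_under_inversion hR φ hφ hodd
  have h1R : (1 : ℂ) ∈ ball (0 : ℂ) R := by simpa using hR
  -- φ agrees with 0 near 1, hence so do its derivatives
  have hev : φ =ᶠ[nhds (1 : ℂ)] fun _ => (0 : ℂ) :=
    (isOpen_ball.mem_nhds h1R |> Filter.eventually_of_mem) fun w hw => hzero w hw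
  have hd1 : deriv φ =ᶠ[nhds (1 : ℂ)] fun _ => (0 : ℂ) := by
    have := hev.deriv
    simpa using this
  refine ⟨hzero, hzero 1 h1R, ?_, ?_⟩
  · simpa using hev.deriv_eq
  · simpa using hd1.deriv_eq

end

end Literature.MathematicalPhysics.QuantumFieldTheory.Balaban1983to89.B12Sec5Algebra
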